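import Mathlib
import HarnessLib

/-!
# The fundamental lemma with a one-sided Lipschitz (logarithmic-norm) constant of any sign

Topic `Literature/Analysis/ODE`.  Mathlib's fundamental lemma
`dist_le_of_approx_trajectories_ODE_of_mem` compares two approximate solutions of `y' = v t y`
under `LipschitzOnWith K (v t) (s t)` with `K : ℝ≥0` and concludes
`dist (f t) (g t) ≤ gronwallBound δ K (εf + εg) (t - a)`.  For STIFF / DISSIPATIVE systems —
in particular for the Galerkin projections `a' = F^n (a)` of a dissipative PDE, whose Lipschitz
constants `‖DF^n‖` blow up with the truncation `n` while the LOGARITHMIC NORMS `μ(DF^n)` stay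
bounded above, uniformly in `n` ([WilczakZgliczynski2025, §4 condition C2]) — the right
hypothesis is Dahlquist's ONE-SIDED Lipschitz condition with a constant `l ∈ ℝ` of ANY SIGN
([HairerNorsettWanner1993, §I.10, (10.17)–(10.22)]): with `m (x) = ‖y (x) - v (x)‖`,
`D₊ m ≤ l m + δ` as soon as `‖(y - v) + h (f y - f v)‖ ≤ (1 + h l + o (h)) ‖y - v‖` for
`h → 0+` (loc. cit. (10.18)), and then `m (x) ≤ e^{l (x - x₀)} (ρ + …)` (Thm. 10.6, (10.22)),
a CONTRACTING estimate when `l < 0`.  This file proves that version on top of Mathlib's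
`le_gronwallBound_of_liminf_deriv_right_le` (which already allows `K : ℝ`).

## Main statements

* `OneSidedLipschitzOnWith l f s`: for `x, y ∈ s` and every `r > l`,
  `‖(x - y) + h • (f x - f y)‖ ≤ (1 + h r) ‖x - y‖` for all small `h > 0`.  Since
  `h ↦ (‖p + h u‖ - ‖p‖) / h` is monotone, this says exactly that the right Gateaux derivative
  of the norm satisfies `D₊ ‖(x - y) + h (f x - f y)‖ |_{h = 0} ≤ l ‖x - y‖` — Dahlquist's
  condition; for a linear `f = Q` on `s = E` it is `μ(Q) ≤ l` with
  `μ(Q) = lim_{h → 0+} (‖I + h Q‖ - 1) / h` the logarithmic norm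
  [HairerNorsettWanner1993, §I.10 Def. 10.4 (10.19)].
  `oneSidedLipschitzOnWith_of_lipschitzOnWith`: `LipschitzOnWith K ⇒ OneSidedLipschitzOnWith K`
  (`μ(Q) ≤ ‖Q‖`).
* `dist_le_of_approx_trajectories_of_oneSidedLipschitz`: THE FUNDAMENTAL LEMMA — Mathlib's
  statement with `LipschitzOnWith K` replaced by `OneSidedLipschitzOnWith l`, `l : ℝ`:
  `dist (f t) (g t) ≤ gronwallBound δ l (εf + εg) (t - a)
   = δ e^{l (t - a)} + (εf + εg) (e^{l (t - a)} - 1) / l` (`= δ + (εf + εg) (t - a)` if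
  `l = 0`).  This is [HairerNorsettWanner1993, §I.10 Thm. 10.6] with constant `ℓ (x) = l`,
  `δ (x) = δ`, and [WilczakZgliczynski2025, Lemma 10] (`‖φ (t, x₀) - y (t)‖ ≤
  e^{l t} ‖y (0) - x₀‖ + δ κ_l (t)`, `κ_l (t) = (e^{l t} - 1) / l`), cf.
  [KapelaZgliczynski2009].  `dist_le_of_trajectories_of_oneSidedLipschitz` is the case of two
  exact solutions: `dist (f t) (g t) ≤ δ e^{l (t - a)}` — uniqueness, continuous dependence and,
  for `l < 0`, exponential contraction ([WilczakZgliczynski2025, Thm. 11 (3)], whose constant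
  `l` is uniform over all Galerkin projections precisely because the hypothesis is one-sided).
* SUPPLIERS of the one-sided estimate from a bound on the derivative on a CONVEX set — the two
  computable formulas of [HairerNorsettWanner1993, §I.10 Thm. 10.5]:
  - Euclidean / Hilbert norm, `μ₂(Q) = λ_max ((Q + Qᵀ) / 2)`, i.e. `⟪Q u, u⟫ ≤ μ ‖u‖²`
    ((10.20), Exercise 5): `inner_sub_le_of_hasFDerivWithinAt` (`⟪D w (η) u, u⟫ ≤ l ‖u‖²` on a
    convex `s` ⇒ `⟪w x - w y, x - y⟫ ≤ l ‖x - y‖²`, by the mean value theorem along the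
    segment) and `oneSidedLipschitzOnWith_of_inner_le` (that monotonicity inequality ⇒
    `OneSidedLipschitzOnWith l w s`);
  - max norm on `ℝ^ι`, `μ_∞(Q) = max_i (q_ii + Σ_{j ≠ i} |q_ij|)` ((10.20')):
    `oneSidedLipschitzOnWith_pi_of_rowSum_le` — if on a convex `s` the derivative `D w (η)`
    has `D_ii + Σ_{j ≠ i} |D_ij| ≤ l` for every row `i` (entries
    `D_ij = D w (η) (e_j) i`), then `OneSidedLipschitzOnWith l w s`.  This Gershgorin-row form
    is what a rigorous integrator evaluates in interval arithmetic on an enclosure `[W]` of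
    `DF^n ([W])` (for `a_k' = -λ_k a_k + N_k (a)` the diagonal `-λ_k → -∞` dominates the row:
    [WilczakZgliczynski2025, §4 Def. 6, condition C2 and the proof of Thm. 11]).

## Proof sketches

Fundamental lemma: with `m = ‖f - g‖`, `p = f x - g x`, `w = v x (f x) - v x (g x)` and
`k = z - x → 0+`, `f z - g z = (p + k • w) + k • d + o (k)` where
`d = (f' x - g' x) - w`, `‖d‖ ≤ εf + εg`; the one-sided estimate with a slope `r'` strictly
between `l` and the required `r` bounds the first bracket by `(1 + k r') ‖p‖`, so the lower
right Dini derivative of `m` at `x` is `< r` whenever `l m (x) + (εf + εg) < r`, which is the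
hypothesis of `le_gronwallBound_of_liminf_deriv_right_le`.  Euclidean supplier: square the
norms, `‖p + k u‖² = ‖p‖² + 2 k ⟪u, p⟫ + k² ‖u‖² ≤ (1 + k r)² ‖p‖²` for small `k` since
`⟪u, p⟫ ≤ l ‖p‖² < r ‖p‖²`.  Max-norm supplier ([HairerNorsettWanner1993, §I.10 proof of
Thm. 10.5/10.6]: "for the norms (9.6'), (9.6'') the `O (h)` term is in fact zero for small
`h`"): for a coordinate `i` where `|p_i| = ‖p‖_∞` with sign `σ`, the mean value theorem applied
to `τ ↦ σ w_i (y + τ p)` and the row bound give `σ u_i ≤ l ‖p‖_∞`, whence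
`|p_i + k u_i| = ‖p‖_∞ + k σ u_i ≤ (1 + k r) ‖p‖_∞` for small `k`; the non-maximal coordinates
have room `‖p‖_∞ - |p_i| > 0` and satisfy the bound for small `k` trivially.

## References

* [HairerNorsettWanner1993] E. Hairer, S. P. Nørsett, G. Wanner, *Solving Ordinary Differential
  Equations I*, 2nd ed., Springer 1993, §I.10 "Differential inequalities": (10.17)–(10.19),
  Def. 10.4 (logarithmic norm), Thm. 10.5 ((10.20), (10.20'), (10.20'')), Thm. 10.6 ((10.21),
  (10.22)), Exercises 4–5.
* [WilczakZgliczynski2025] D. Wilczak, P. Zgliczyński, *Self-consistent bounds method for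
  dissipative PDEs*, arXiv:2502.09760, §3.2 Lemma 10 (`lem:estmLogN`), §4 Def. 4–6
  (conditions S, C1, C2), Thm. 11.
* [KapelaZgliczynski2009] T. Kapela, P. Zgliczyński, *A Lohner-type algorithm for control
  systems and ordinary differential inclusions*, Discrete Contin. Dyn. Syst. B 11 (2009) — the
  logarithmic-norm lemma for perturbed systems quoted as [WilczakZgliczynski2025, Lemma 8].
* Mathlib: `gronwallBound`, `le_gronwallBound_of_liminf_deriv_right_le`,
  `dist_le_of_approx_trajectories_ODE_of_mem` (the Lipschitz version this file generalises).
-/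

open Set Filter Topology
open scoped NNReal InnerProductSpace

namespace Literature.Analysis.ODE

noncomputable section

variable {E : Type*} [NormedAddCommGroup E] [NormedSpace ℝ E]

/-- Dahlquist's ONE-SIDED LIPSCHITZ condition with constant `l ∈ ℝ` for `f` on `s`: for
`x, y ∈ s` and every slope `r > l`, `‖(x - y) + h • (f x - f y)‖ ≤ (1 + h r) ‖x - y‖` for all
sufficiently small `h > 0`; equivalently (the difference quotient of the convex function
`h ↦ ‖p + h u‖` being monotone) `D₊ ‖(x - y) + h (f x - f y)‖ |_{h=0} ≤ l ‖x - y‖`.  For a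
linear map this is `μ(Q) ≤ l`, `μ` the logarithmic norm.
[cite: HairerNorsettWanner1993, §I.10 (10.17)–(10.19) and Def. 10.4] -/
def OneSidedLipschitzOnWith (l : ℝ) (f : E → E) (s : Set E) : Prop :=
  ∀ x ∈ s, ∀ y ∈ s, ∀ r : ℝ, l < r →
    ∀ᶠ h in 𝓝[>] (0 : ℝ), ‖(x - y) + h • (f x - f y)‖ ≤ (1 + h * r) * ‖x - y‖

namespace OneSidedLipschitzOnWith

variable {l l' : ℝ} {f : E → E} {s s' : Set E}

/-- Restriction to a smaller set. [cite: HairerNorsettWanner1993, §I.10 (10.21)] -/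
theorem mono (h : OneSidedLipschitzOnWith l f s) (hs : s' ⊆ s) : OneSidedLipschitzOnWith l f s' :=
  fun x hx y hy r hr => h x (hs hx) y (hs hy) r hr

/-- A larger constant. [cite: HairerNorsettWanner1993, §I.10 (10.21)] -/
theorem mono_const (h : OneSidedLipschitzOnWith l f s) (hl : l ≤ l') :
    OneSidedLipschitzOnWith l' f s :=
  fun x hx y hy r hr => h x hx y hy r (lt_of_le_of_lt hl hr)

end OneSidedLipschitzOnWith

/-- A Lipschitz map is one-sided Lipschitz with the same constant (`-‖Q‖ ≤ μ(Q) ≤ ‖Q‖`).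
[cite: HairerNorsettWanner1993, §I.10 Exercise 4 and (10.19)] -/
theorem oneSidedLipschitzOnWith_of_lipschitzOnWith {K : ℝ≥0} {f : E → E} {s : Set E}
    (hf : LipschitzOnWith K f s) : OneSidedLipschitzOnWith K f s := by
  intro x hx y hy r hr
  filter_upwards [self_mem_nhdsWithin] with h hh
  have hh' : (0 : ℝ) < h := hh
  have hK := hf.norm_sub_le hx hy
  calc ‖(x - y) + h • (f x - f y)‖ ≤ ‖x - y‖ + ‖h • (f x - f y)‖ := norm_add_le _ _
    _ = ‖x - y‖ + h * ‖f x - f y‖ := by rw [norm_smul, Real.norm_eq_abs, abs_of_pos hh']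
    _ ≤ ‖x - y‖ + h * (K * ‖x - y‖) := by gcongr
    _ ≤ (1 + h * r) * ‖x - y‖ := by
      have : 0 ≤ h * ((r - K) * ‖x - y‖) :=
        mul_nonneg hh'.le (mul_nonneg (sub_nonneg.2 hr.le) (norm_nonneg _))
      nlinarith

/-! ## The fundamental lemma -/

/-- `z ↦ z - x` maps the right neighbourhood filter of `x` to that of `0`. [folklore] -/
private theorem tendsto_sub_nhdsGT (x : ℝ) :
    Tendsto (fun z : ℝ => z - x) (𝓝[>] x) (𝓝[>] (0 : ℝ)) := by
  refine tendsto_nhdsWithin_iff.2 ⟨?_, ?_⟩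
  · exact ((continuous_sub_right x).tendsto' x 0 (sub_self x)).mono_left nhdsWithin_le_nhds
  · exact eventually_nhdsWithin_of_forall fun z hz => Set.mem_Ioi.2 (sub_pos.2 hz)

/-- **The fundamental lemma with a one-sided Lipschitz constant `l ∈ ℝ`.**  If `f` and `g`
are two approximate solutions of `y' = v t y` on `[a, b]` (right derivatives `f'`, `g'` with
`dist (f' t) (v t (f t)) ≤ εf`, `dist (g' t) (v t (g t)) ≤ εg`), staying in sets `s t` on
which `v t` is one-sided Lipschitz with constant `l`, and `dist (f a) (g a) ≤ δ`, then
`dist (f t) (g t) ≤ gronwallBound δ l (εf + εg) (t - a) = δ e^{l (t - a)} +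
(εf + εg) (e^{l (t - a)} - 1) / l`.  Mathlib's `dist_le_of_approx_trajectories_ODE_of_mem`
is the case `LipschitzOnWith K`, `K ≥ 0`; here `l` may be negative.
[cite: HairerNorsettWanner1993, §I.10 Thm. 10.6 with (10.18), constant ℓ and δ]
[cite: WilczakZgliczynski2025, §3.2 Lemma 10] -/
theorem dist_le_of_approx_trajectories_of_oneSidedLipschitz
    {v : ℝ → E → E} {s : ℝ → Set E} {l : ℝ} {f g f' g' : ℝ → E} {a b εf εg δ : ℝ}
    (hv : ∀ t ∈ Ico a b, OneSidedLipschitzOnWith l (v t) (s t))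
    (hf : ContinuousOn f (Icc a b))
    (hf' : ∀ t ∈ Ico a b, HasDerivWithinAt f (f' t) (Ici t) t)
    (f_bound : ∀ t ∈ Ico a b, dist (f' t) (v t (f t)) ≤ εf)
    (hfs : ∀ t ∈ Ico a b, f t ∈ s t)
    (hg : ContinuousOn g (Icc a b))
    (hg' : ∀ t ∈ Ico a b, HasDerivWithinAt g (g' t) (Ici t) t)
    (g_bound : ∀ t ∈ Ico a b, dist (g' t) (v t (g t)) ≤ εg)
    (hgs : ∀ t ∈ Ico a b, g t ∈ s t)
    (ha : dist (f a) (g a) ≤ δ) :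
    ∀ t ∈ Icc a b, dist (f t) (g t) ≤ gronwallBound δ l (εf + εg) (t - a) := by
  have hm : ContinuousOn (fun t => ‖f t - g t‖) (Icc a b) := (hf.sub hg).norm
  intro t ht
  rw [dist_eq_norm]
  refine le_gronwallBound_of_liminf_deriv_right_le (f := fun t => ‖f t - g t‖)
    (f' := fun t => l * ‖f t - g t‖ + (εf + εg)) hm ?_ (by simpa [dist_eq_norm] using ha)
    (fun x _ => le_rfl) t ht
  intro x hx r hr
  set p := f x - g x with hp
  set w := v x (f x) - v x (g x) with hw
  set d := (f' x - g' x) - w with hd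
  have hd_le : ‖d‖ ≤ εf + εg := by
    have h1 := f_bound x hx
    have h2 := g_bound x hx
    rw [dist_eq_norm] at h1 h2
    calc ‖d‖ = ‖(f' x - v x (f x)) - (g' x - v x (g x))‖ := by
            rw [hd, hw]; congr 1; abel
      _ ≤ ‖f' x - v x (f x)‖ + ‖g' x - v x (g x)‖ := norm_sub_le _ _
      _ ≤ εf + εg := add_le_add h1 h2
  -- a slope `r'` strictly between `l` and what is needed
  set ε := εf + εg with hε
  have hgap : 0 < r - (l * ‖p‖ + ε) := sub_pos.2 hr
  set r' := l + (r - (l * ‖p‖ + ε)) / (2 * (‖p‖ + 1)) with hr'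
  have hp0 : 0 ≤ ‖p‖ := norm_nonneg _
  have hlr' : l < r' := by
    have : 0 < (r - (l * ‖p‖ + ε)) / (2 * (‖p‖ + 1)) := by positivity
    linarith
  have hr'2 : r' * ‖p‖ + ε + (r - (l * ‖p‖ + ε)) / 2 < r := by
    have hq : ‖p‖ / (‖p‖ + 1) < 1 := by
      rw [div_lt_one (by positivity)]; linarith
    have hident : r' * ‖p‖ + ε + (r - (l * ‖p‖ + ε)) / 2
        = (l * ‖p‖ + ε) + (r - (l * ‖p‖ + ε)) / 2 * (‖p‖ / (‖p‖ + 1))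
          + (r - (l * ‖p‖ + ε)) / 2 := by
      rw [hr']; field_simp; ring
    rw [hident]
    nlinarith [mul_lt_mul_of_pos_left hq (half_pos hgap)]
  -- the one-sided estimate at `x`
  have hos : ∀ᶠ z in 𝓝[>] x, ‖p + (z - x) • w‖ ≤ (1 + (z - x) * r') * ‖p‖ :=
    (tendsto_sub_nhdsGT x).eventually (hv x hx (f x) (hfs x hx) (g x) (hgs x hx) r' hlr')
  -- the derivative of `f - g` at `x` within `Ici x`, little-o form, restricted to `𝓝[>] x`
  have hderiv : HasDerivWithinAt (fun t => f t - g t) (f' x - g' x) (Ici x) x :=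
    (hf' x hx).sub (hg' x hx)
  have hlo := (hasDerivWithinAt_iff_isLittleO.1 hderiv).def (half_pos hgap)
  have hlo' : ∀ᶠ z in 𝓝[>] x,
      ‖f z - g z - (f x - g x) - (z - x) • (f' x - g' x)‖ ≤ (r - (l * ‖p‖ + ε)) / 2 * ‖z - x‖ :=
    hlo.filter_mono (nhdsWithin_mono _ Ioi_subset_Ici_self)
  have hpos : ∀ᶠ z in 𝓝[>] x, x < z := eventually_mem_nhdsWithin
  refine ((hos.and hlo').and hpos).mono ?_ |>.frequently
  rintro z ⟨⟨hz1, hz2⟩, hz3⟩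
  have hk : 0 < z - x := sub_pos.2 hz3
  set k := z - x with hkdef
  set R := f z - g z - (f x - g x) - k • (f' x - g' x) with hR
  have hsplit : f z - g z = (p + k • w) + (k • d + R) := by
    rw [hR, hd, hp]; module
  have hRk : ‖R‖ ≤ (r - (l * ‖p‖ + ε)) / 2 * k := by
    simpa [Real.norm_eq_abs, abs_of_pos hk] using hz2
  have hkd : ‖k • d‖ ≤ k * ε := by
    rw [norm_smul, Real.norm_eq_abs, abs_of_pos hk]
    exact mul_le_mul_of_nonneg_left hd_le hk.le
  have key : ‖f z - g z‖ - ‖p‖ ≤ k * (r' * ‖p‖ + ε + (r - (l * ‖p‖ + ε)) / 2) := by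
    have h1 : ‖f z - g z‖ ≤ ‖p + k • w‖ + (‖k • d‖ + ‖R‖) := by
      rw [hsplit]; exact norm_add_le_of_le le_rfl (norm_add_le _ _)
    nlinarith [h1, hz1, hRk, hkd]
  show k⁻¹ * (‖f z - g z‖ - ‖f x - g x‖) < r
  rw [← hp, inv_mul_lt_iff₀ hk]
  calc ‖f z - g z‖ - ‖p‖ ≤ k * (r' * ‖p‖ + ε + (r - (l * ‖p‖ + ε)) / 2) := key
    _ < k * r := mul_lt_mul_of_pos_left hr'2 hk

/-- Two exact solutions of `y' = v t y` staying where `v t` is one-sided Lipschitz with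
constant `l ∈ ℝ`: `dist (f t) (g t) ≤ δ e^{l (t - a)}` — uniqueness and continuous dependence,
and exponential CONTRACTION when `l < 0`.
[cite: HairerNorsettWanner1993, §I.10 Thm. 10.6 with δ = 0]
[cite: WilczakZgliczynski2025, §3.2 Lemma 10 with δ = 0, and Thm. 11 (3)] -/
theorem dist_le_of_trajectories_of_oneSidedLipschitz
    {v : ℝ → E → E} {s : ℝ → Set E} {l : ℝ} {f g : ℝ → E} {a b δ : ℝ}
    (hv : ∀ t ∈ Ico a b, OneSidedLipschitzOnWith l (v t) (s t))
    (hf : ContinuousOn f (Icc a b))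
    (hf' : ∀ t ∈ Ico a b, HasDerivWithinAt f (v t (f t)) (Ici t) t)
    (hfs : ∀ t ∈ Ico a b, f t ∈ s t)
    (hg : ContinuousOn g (Icc a b))
    (hg' : ∀ t ∈ Ico a b, HasDerivWithinAt g (v t (g t)) (Ici t) t)
    (hgs : ∀ t ∈ Ico a b, g t ∈ s t)
    (ha : dist (f a) (g a) ≤ δ) :
    ∀ t ∈ Icc a b, dist (f t) (g t) ≤ δ * Real.exp (l * (t - a)) := by
  intro t ht
  have := dist_le_of_approx_trajectories_of_oneSidedLipschitz hv hf hf'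
    (fun t _ => (dist_self _).le) hfs hg hg' (fun t _ => (dist_self _).le) hgs ha t ht
  simpa [gronwallBound_ε0] using this

/-! ## Suppliers of the one-sided estimate -/

section InnerProduct

variable {F : Type*} [NormedAddCommGroup F] [InnerProductSpace ℝ F]

/-- Euclidean / Hilbert norm: the monotonicity inequality `⟪w x - w y, x - y⟫ ≤ l ‖x - y‖²`
on `s` gives `OneSidedLipschitzOnWith l w s` (`μ₂(Q) = λ_max ((Q + Qᵀ) / 2)` = the least `μ`
with `⟪Q v, v⟫ ≤ μ ‖v‖²`).
[cite: HairerNorsettWanner1993, §I.10 Thm. 10.5 (10.20) and Exercise 5] -/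
theorem oneSidedLipschitzOnWith_of_inner_le {w : F → F} {s : Set F} {l : ℝ}
    (h : ∀ x ∈ s, ∀ y ∈ s, ⟪w x - w y, x - y⟫_ℝ ≤ l * ‖x - y‖ ^ 2) :
    OneSidedLipschitzOnWith l w s := by
  intro x hx y hy r hr
  set p := x - y with hp
  set u := w x - w y with hu
  by_cases hp0 : p = 0
  · have hxy : x = y := sub_eq_zero.1 (hp ▸ hp0)
    have hu0 : u = 0 := by rw [hu, hxy, sub_self]
    filter_upwards [self_mem_nhdsWithin] with k hk
    simp [hp0, hu0]
  have hp_pos : 0 < ‖p‖ := norm_pos_iff.2 hp0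
  have key : ⟪u, p⟫_ℝ ≤ l * ‖p‖ ^ 2 := h x hx y hy
  have hrl : 0 < r - l := sub_pos.2 hr
  have hk0 : 0 < 2 * (r - l) * ‖p‖ ^ 2 / (‖u‖ ^ 2 + 1) := by positivity
  have ev1 : ∀ᶠ k in 𝓝[>] (0 : ℝ), k < 2 * (r - l) * ‖p‖ ^ 2 / (‖u‖ ^ 2 + 1) :=
    mem_nhdsWithin_of_mem_nhds (Iio_mem_nhds hk0)
  have ev2 : ∀ᶠ k in 𝓝[>] (0 : ℝ), 0 < 1 + k * r := by
    have hc : Tendsto (fun k : ℝ => 1 + k * r) (𝓝 0) (𝓝 (1 + 0 * r)) :=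
      ((continuous_const.add (continuous_id.mul continuous_const)).tendsto 0)
    have : Tendsto (fun k : ℝ => 1 + k * r) (𝓝[>] 0) (𝓝 1) := by
      simpa using hc.mono_left nhdsWithin_le_nhds
    exact this.eventually_const_lt (by norm_num)
  filter_upwards [self_mem_nhdsWithin, ev1, ev2] with k hk hk1 hk2
  have hk' : (0 : ℝ) < k := hk
  have hk1' : k * (‖u‖ ^ 2 + 1) < 2 * (r - l) * ‖p‖ ^ 2 := (lt_div_iff₀ (by positivity)).1 hk1
  have hsq : ‖p + k • u‖ ^ 2 ≤ ((1 + k * r) * ‖p‖) ^ 2 := by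
    rw [norm_add_sq_real, norm_smul, Real.norm_eq_abs, abs_of_pos hk', inner_smul_right,
      real_inner_comm]
    have h1 : 2 * k * ⟪u, p⟫_ℝ ≤ 2 * k * (l * ‖p‖ ^ 2) :=
      mul_le_mul_of_nonneg_left key (by positivity)
    have h2 : k * (k * (‖u‖ ^ 2 + 1)) ≤ k * (2 * (r - l) * ‖p‖ ^ 2) :=
      mul_le_mul_of_nonneg_left hk1'.le hk'.le
    nlinarith [h1, h2, sq_nonneg (k * r * ‖p‖), sq_nonneg k, sq_nonneg ‖u‖]
  have hnn : 0 ≤ (1 + k * r) * ‖p‖ := mul_nonneg hk2.le hp_pos.le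
  calc ‖p + k • u‖ = Real.sqrt (‖p + k • u‖ ^ 2) := (Real.sqrt_sq (norm_nonneg _)).symm
    _ ≤ Real.sqrt (((1 + k * r) * ‖p‖) ^ 2) := Real.sqrt_le_sqrt hsq
    _ = (1 + k * r) * ‖p‖ := Real.sqrt_sq hnn

/-- From the derivative to the monotonicity inequality: if `w` is differentiable within a
convex set `s` with `⟪D w (η) u, u⟫ ≤ l ‖u‖²` for all `η ∈ s` (i.e. `μ₂(D w (η)) ≤ l`), then
`⟪w x - w y, x - y⟫ ≤ l ‖x - y‖²` on `s` (mean value theorem along the segment).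
[cite: HairerNorsettWanner1993, §I.10 Thm. 10.5 (10.20) with Thm. 10.6 (10.21)] -/
theorem inner_sub_le_of_hasFDerivWithinAt {w : F → F} {s : Set F} (hs : Convex ℝ s)
    {D : F → F →L[ℝ] F} (hD : ∀ η ∈ s, HasFDerivWithinAt w (D η) s η) {l : ℝ}
    (hl : ∀ η ∈ s, ∀ u : F, ⟪D η u, u⟫_ℝ ≤ l * ‖u‖ ^ 2) :
    ∀ x ∈ s, ∀ y ∈ s, ⟪w x - w y, x - y⟫_ℝ ≤ l * ‖x - y‖ ^ 2 := by
  intro x hx y hy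
  set p := x - y with hp
  have hγ : ∀ τ ∈ Icc (0 : ℝ) 1, y + τ • p ∈ s := fun τ hτ => hs.add_smul_sub_mem hy hx hτ
  have hφ : ∀ τ ∈ Icc (0 : ℝ) 1, HasDerivWithinAt (fun τ : ℝ => ⟪w (y + τ • p), p⟫_ℝ)
      (⟪D (y + τ • p) p, p⟫_ℝ) (Icc 0 1) τ := by
    intro τ hτ
    have h1 : HasDerivWithinAt (fun τ : ℝ => y + τ • p) p (Icc 0 1) τ := by
      have := ((hasDerivWithinAt_id τ (Icc (0 : ℝ) 1)).smul_const p).const_add y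
      simpa using this
    have h3 : HasDerivWithinAt (fun τ : ℝ => w (y + τ • p)) (D (y + τ • p) p) (Icc 0 1) τ :=
      (hD _ (hγ τ hτ)).comp_hasDerivWithinAt τ h1 (fun σ hσ => hγ σ hσ)
    have h4 := h3.inner ℝ (hasDerivWithinAt_const τ (Icc (0 : ℝ) 1) p)
    simpa using h4
  have hcont : ContinuousOn (fun τ : ℝ => ⟪w (y + τ • p), p⟫_ℝ) (Icc 0 1) :=
    fun τ hτ => (hφ τ hτ).continuousWithinAt
  obtain ⟨c, hc, hc'⟩ := exists_hasDerivAt_eq_slope (fun τ : ℝ => ⟪w (y + τ • p), p⟫_ℝ)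
    (fun τ => ⟪D (y + τ • p) p, p⟫_ℝ) zero_lt_one hcont
    (fun τ hτ => (hφ τ (Ioo_subset_Icc_self hτ)).hasDerivAt (Icc_mem_nhds hτ.1 hτ.2))
  have hid : ⟪w x - w y, p⟫_ℝ = ⟪D (y + c • p) p, p⟫_ℝ := by
    rw [hc', inner_sub_left]
    simp [hp]
  rw [hid]
  exact hl _ (hγ c (Ioo_subset_Icc_self hc)) p

end InnerProduct

section SupNorm

variable {ι : Type*} [DecidableEq ι]

/-- `Pi.single j c = c • Pi.single j 1` in `ι → ℝ`. [folklore] -/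
private theorem pi_single_eq_smul (j : ι) (c : ℝ) :
    (Pi.single j c : ι → ℝ) = c • (Pi.single j (1 : ℝ) : ι → ℝ) := by
  ext k
  by_cases hk : k = j
  · subst hk; simp
  · simp [hk]

variable [Fintype ι]

/-- Matrix entries of a linear map of `ℝ^ι`: `(A p) i = Σ_j p j * A (e_j) i`. [folklore] -/
private theorem clm_apply_eq_sum (A : (ι → ℝ) →L[ℝ] (ι → ℝ)) (p : ι → ℝ) (i : ι) :
    A p i = ∑ j, p j * A (Pi.single j 1) i := by
  conv_lhs => rw [← Finset.univ_sum_single p]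
  rw [map_sum, Finset.sum_apply]
  refine Finset.sum_congr rfl fun j _ => ?_
  rw [pi_single_eq_smul, map_smul, Pi.smul_apply, smul_eq_mul]

/-- Max norm on `ℝ^ι` (`μ_∞(Q) = max_i (q_ii + Σ_{j ≠ i} |q_ij|)`): if `w` is differentiable
within a convex set `s` and every row of its derivative satisfies the Gershgorin-type bound
`D w (η) (e_i) i + Σ_{j ≠ i} |D w (η) (e_j) i| ≤ l` (`η ∈ s`), then
`OneSidedLipschitzOnWith l w s` for the sup norm.  This is the formula a rigorous integrator
evaluates on an interval enclosure of `DF^n ([W])`.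
[cite: HairerNorsettWanner1993, §I.10 Thm. 10.5 (10.20') with Thm. 10.6 (10.21)]
[cite: WilczakZgliczynski2025, §4 Def. 6 (condition C2) and proof of Thm. 11] -/
theorem oneSidedLipschitzOnWith_pi_of_rowSum_le {w : (ι → ℝ) → ι → ℝ} {s : Set (ι → ℝ)}
    (hs : Convex ℝ s) {D : (ι → ℝ) → (ι → ℝ) →L[ℝ] (ι → ℝ)}
    (hD : ∀ η ∈ s, HasFDerivWithinAt w (D η) s η) {l : ℝ}
    (hrow : ∀ η ∈ s, ∀ i,
      D η (Pi.single i 1) i + ∑ j ∈ Finset.univ.erase i, |D η (Pi.single j 1) i| ≤ l) :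
    OneSidedLipschitzOnWith l w s := by
  intro x hx y hy r hr
  set p := x - y with hp
  set u := w x - w y with hu
  by_cases hp0 : p = 0
  · have hxy : x = y := sub_eq_zero.1 (hp ▸ hp0)
    have hu0 : u = 0 := by rw [hu, hxy, sub_self]
    filter_upwards [self_mem_nhdsWithin] with k hk
    simp [hp0, hu0]
  have hp_pos : 0 < ‖p‖ := norm_pos_iff.2 hp0
  have hγ : ∀ τ ∈ Icc (0 : ℝ) 1, y + τ • p ∈ s := fun τ hτ => hs.add_smul_sub_mem hy hx hτ
  -- Step 1: along a maximal coordinate `i` (with sign `σ`), `σ u_i ≤ l ‖p‖`.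
  have hmax : ∀ i, ∀ σ : ℝ, (σ = 1 ∨ σ = -1) → σ * p i = ‖p‖ → σ * u i ≤ l * ‖p‖ := by
    intro i σ hσ hpi
    have hσabs : |σ| = 1 := by rcases hσ with rfl | rfl <;> simp
    have hφ : ∀ τ ∈ Icc (0 : ℝ) 1, HasDerivWithinAt (fun τ : ℝ => σ * w (y + τ • p) i)
        (σ * D (y + τ • p) p i) (Icc 0 1) τ := by
      intro τ hτ
      have h1 : HasDerivWithinAt (fun τ : ℝ => y + τ • p) p (Icc 0 1) τ := by
        have := ((hasDerivWithinAt_id τ (Icc (0 : ℝ) 1)).smul_const p).const_add y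
        simpa using this
      have h3 : HasDerivWithinAt (fun τ : ℝ => w (y + τ • p)) (D (y + τ • p) p) (Icc 0 1) τ :=
        (hD _ (hγ τ hτ)).comp_hasDerivWithinAt τ h1 (fun σ hσ => hγ σ hσ)
      exact ((hasDerivWithinAt_pi.1 h3) i).const_mul σ
    have hφ' : ∀ τ ∈ Icc (0 : ℝ) 1, σ * D (y + τ • p) p i ≤ l * ‖p‖ := by
      intro τ hτ
      set A := D (y + τ • p) with hA
      rw [clm_apply_eq_sum A p i, Finset.mul_sum, ← Finset.add_sum_erase _ _ (Finset.mem_univ i)]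
      have hdiag : σ * (p i * A (Pi.single i 1) i) = ‖p‖ * A (Pi.single i 1) i := by
        rw [← mul_assoc, hpi]
      have hoff : ∀ j ∈ Finset.univ.erase i,
          σ * (p j * A (Pi.single j 1) i) ≤ ‖p‖ * |A (Pi.single j 1) i| := by
        intro j _
        have hpj : |p j| ≤ ‖p‖ := by simpa [Real.norm_eq_abs] using norm_le_pi_norm p j
        calc σ * (p j * A (Pi.single j 1) i) ≤ |σ * (p j * A (Pi.single j 1) i)| := le_abs_self _
          _ = |p j| * |A (Pi.single j 1) i| := by rw [abs_mul, abs_mul, hσabs, one_mul]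
          _ ≤ ‖p‖ * |A (Pi.single j 1) i| := mul_le_mul_of_nonneg_right hpj (abs_nonneg _)
      calc σ * (p i * A (Pi.single i 1) i) + ∑ j ∈ Finset.univ.erase i, σ * (p j * A (Pi.single j 1) i)
          ≤ ‖p‖ * A (Pi.single i 1) i + ∑ j ∈ Finset.univ.erase i, ‖p‖ * |A (Pi.single j 1) i| := by
            rw [hdiag]; exact add_le_add le_rfl (Finset.sum_le_sum hoff)
        _ = ‖p‖ * (A (Pi.single i 1) i + ∑ j ∈ Finset.univ.erase i, |A (Pi.single j 1) i|) := by
            rw [mul_add, Finset.mul_sum]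
        _ ≤ ‖p‖ * l := mul_le_mul_of_nonneg_left (hrow _ (hγ τ hτ) i) (norm_nonneg _)
        _ = l * ‖p‖ := mul_comm _ _
    have hcont : ContinuousOn (fun τ : ℝ => σ * w (y + τ • p) i) (Icc 0 1) :=
      fun τ hτ => (hφ τ hτ).continuousWithinAt
    obtain ⟨c, hc, hc'⟩ := exists_hasDerivAt_eq_slope (fun τ : ℝ => σ * w (y + τ • p) i)
      (fun τ => σ * D (y + τ • p) p i) zero_lt_one hcont
      (fun τ hτ => (hφ τ (Ioo_subset_Icc_self hτ)).hasDerivAt (Icc_mem_nhds hτ.1 hτ.2))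
    have hid : σ * u i = σ * D (y + c • p) p i := by
      rw [hc', hu]
      simp [hp, mul_sub]
    rw [hid]
    exact hφ' c (Ioo_subset_Icc_self hc)
  -- Step 2: per-coordinate eventual bounds.
  have hcoord : ∀ i, ∀ᶠ k in 𝓝[>] (0 : ℝ), |p i + k * u i| ≤ (1 + k * r) * ‖p‖ := by
    intro i
    have hpi_le : |p i| ≤ ‖p‖ := by simpa [Real.norm_eq_abs] using norm_le_pi_norm p i
    by_cases hpi : |p i| = ‖p‖
    · -- maximal coordinate: σ := sign of `p i`
      obtain ⟨σ, hσ, hσp⟩ : ∃ σ : ℝ, (σ = 1 ∨ σ = -1) ∧ σ * p i = ‖p‖ := by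
        rcases (abs_eq (norm_nonneg p)).1 hpi with h | h
        · exact ⟨1, Or.inl rfl, by rw [one_mul, h]⟩
        · exact ⟨-1, Or.inr rfl, by rw [h]; ring⟩
      have hσabs : |σ| = 1 := by rcases hσ with rfl | rfl <;> simp
      have hσsq : σ * σ = 1 := by rcases hσ with rfl | rfl <;> norm_num
      have hui : σ * u i ≤ l * ‖p‖ := hmax i σ hσ hσp
      have hT : Tendsto (fun k : ℝ => k * |u i|) (𝓝[>] 0) (𝓝 0) := by
        have := (tendsto_id.mul_const (|u i|) :
          Tendsto (fun k : ℝ => k * |u i|) (𝓝 (0 : ℝ)) (𝓝 (0 * |u i|)))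
        rw [zero_mul] at this
        exact this.mono_left nhdsWithin_le_nhds
      have ev : ∀ᶠ k in 𝓝[>] (0 : ℝ), k * |u i| < ‖p‖ := hT.eventually_lt_const hp_pos
      filter_upwards [ev, self_mem_nhdsWithin] with k hk1 hk
      have hk' : (0 : ℝ) < k := hk
      have habs : |p i + k * u i| = |‖p‖ + k * (σ * u i)| := by
        have : σ * (p i + k * u i) = ‖p‖ + k * (σ * u i) := by rw [mul_add, hσp]; ring
        rw [← this, abs_mul, hσabs, one_mul]
      have hsu : |σ * u i| = |u i| := by rw [abs_mul, hσabs, one_mul]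
      have h0 : 0 ≤ ‖p‖ + k * (σ * u i) := by
        nlinarith [neg_abs_le (σ * u i), hsu, hk1, hk'.le]
      rw [habs, abs_of_nonneg h0]
      have hlr : l * ‖p‖ ≤ r * ‖p‖ := mul_le_mul_of_nonneg_right hr.le (norm_nonneg _)
      have hkr : k * (σ * u i) ≤ k * (r * ‖p‖) :=
        mul_le_mul_of_nonneg_left (hui.trans hlr) hk'.le
      nlinarith [hkr]
    · have hlt : |p i| < ‖p‖ := lt_of_le_of_ne hpi_le hpi
      have hT : Tendsto (fun k : ℝ => k * (|u i| - r * ‖p‖)) (𝓝[>] 0) (𝓝 0) := by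
        have := (tendsto_id.mul_const (|u i| - r * ‖p‖) :
          Tendsto (fun k : ℝ => k * (|u i| - r * ‖p‖)) (𝓝 (0 : ℝ)) (𝓝 (0 * (|u i| - r * ‖p‖))))
        rw [zero_mul] at this
        exact this.mono_left nhdsWithin_le_nhds
      have ev : ∀ᶠ k in 𝓝[>] (0 : ℝ), k * (|u i| - r * ‖p‖) < ‖p‖ - |p i| :=
        hT.eventually_lt_const (sub_pos.2 hlt)
      filter_upwards [ev, self_mem_nhdsWithin] with k hk1 hk
      have hk' : (0 : ℝ) < k := hk
      calc |p i + k * u i| ≤ |p i| + |k * u i| := abs_add_le _ _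
        _ = |p i| + k * |u i| := by rw [abs_mul, abs_of_pos hk']
        _ ≤ (1 + k * r) * ‖p‖ := by nlinarith [hk1]
  -- Step 3: assemble the sup norm.
  have ev_nonneg : ∀ᶠ k in 𝓝[>] (0 : ℝ), 0 < 1 + k * r := by
    have hc : Tendsto (fun k : ℝ => 1 + k * r) (𝓝 0) (𝓝 (1 + 0 * r)) :=
      ((continuous_const.add (continuous_id.mul continuous_const)).tendsto 0)
    have : Tendsto (fun k : ℝ => 1 + k * r) (𝓝[>] 0) (𝓝 1) := by
      simpa using hc.mono_left nhdsWithin_le_nhds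
    exact this.eventually_const_lt (by norm_num)
  filter_upwards [eventually_all.2 hcoord, ev_nonneg] with k hk hk'
  refine (pi_norm_le_iff_of_nonneg (mul_nonneg hk'.le (norm_nonneg _))).2 fun i => ?_
  simpa [Real.norm_eq_abs] using hk i

end SupNorm

end

end Literature.Analysis.ODE
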